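import Summits.RiemannHypothesis.RiemannHypothesis.Theorems.Splittings.ZdContinuousReferencePins
import HarnessLib

/-!
# Local reference pins, radii, and the explicit-formula (prime) pin (zd-neg g10 §2b)

Cell rh-split, seat rh-split-zd-neg g10 (brief sha16 f79c5f09d8bcb036), card `run/shared/lean/pub/rh-split/cards/SPLIT-zd-neg.md` GEN-10
(N65–N68, R57–R61, B11–B12 + SUPPLEMENT); source `HOME/rh-split-zd-neg/SketchG10.lean` v2 sha16 29368ce59f30369a (namespace `RhSplitZdNegG10`),
referee rh-split-ref-2 g0: GEN-10 REPLAY PASS on kernel v2 + CONTENT read-backs R1–R10 + LABELS N65–N68 UPHELD (2026-08-27T09:34:25Z, `INBOX.md`);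
lead rh-split-lead g3; CARVE MAP + CUT.md in `HOME/rh-split-zd-neg/carve-g10/`.  Deltas vs the source (CUT.md): namespace ↦ `…Splittings.<lane>`, the scratch
abbreviations `FIN` / `H₀` SPELLED OUT (`riemannHypothesisUpTo_platt_trudgian` / `3000175332800`), the §0/§1 frame decls CITED from the tree
(`Splittings.ZdReferencePinsFrame`: `RHAbove`, `rh_of_fin_of_rhAbove`, `rhAbove_of_rh`, `two_le_count_jump`, `zetaArgS_sub`) instead of restated,
`primesLE_mono` ↦ Mathlib `Nat.primesLE_mono`, `abs_sin_sub_sin_le` privatised, docstrings added to helper decls; decl text otherwise byte-verbatim.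

This file: §2b `RefPinR` (radius), the RATE refutations `not_refPinR_of_le_rate` / `not_refPinR_of_ge_rate` / `not_refPin_of_le_rate` /
`refPin_residue_rate` (Selberg Ω± with its rate), `LocalRefPin` + `count_jump_lt_two_of_localRefPin` / `rhAbove_of_localRefPin` /
`order_eq_one_of_localRefPin` (the jump principle is local), `abs_primeSin_le` / `not_refPinR_primeSin` (fixed-scale prime sums pin nothing),
and N68 `PrimePin a r H` with `localRefPin_of_primePin`, `rhAbove_of_primePin`, `order_eq_one_of_primePin`, `rh_of_fin_of_primePin` (VALID ∀ a, ∀ r ≤ 1).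

HONEST LABEL: «SPLITTING SEARCH over kernel-typed RH-EQUIVALENCES; a splitting A ∧ B ⟹ RH is CONDITIONAL bookkeeping unless A and B are
both proved; nothing here bears on the truth of RH.»
-/

set_option linter.dupNamespace false

noncomputable section

open Filter Complex Metric Set
open scoped Real Topology

namespace Summit.RiemannHypothesis.RiemannHypothesis.Theorems.Splittings.ZdPrimePin

open Literature.NumberTheory.DiophantineGeometry Literature.NumberTheory.LFunctions
  Literature.Barriers.RiemannHypothesis MeasureTheory
open Summit.RiemannHypothesis.RiemannHypothesis.Theorems.Splittings.ZdReferencePins (RHAbove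
  rh_of_fin_of_rhAbove rhAbove_of_rh two_le_count_jump zetaArgS_sub)
open Summit.RiemannHypothesis.RiemannHypothesis.Theorems.Splittings.ZdTwoHeightMeanSquare (primeSin
  continuous_primeSin' im_sq_integral_ge primesLE_subset_Icc_sq sizes_aux intervalIntegrable_selbergE_sq)

/-! ## §2b Local pins, radii, and the explicit-formula (prime) reference

The jump principle is LOCAL: it needs one reference, continuous at `γ` from the left, pinning `S`
on a left-neighbourhood of `γ`.  This types N68 (`PrimePin`): Selberg's approximant
`−π⁻¹ Σ_{p<X} sin(t log p)/√p` at the CO-GROWING scale `X = ⌊T^a⌋₊` on `[T/2, T]`, for every `T ≥ H`.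
Every such pin of radius `≤ 1` splits (kernel); every FIXED-scale prime reference is bounded, hence
pins `S` at no radius (kernel, Selberg `Ω±`). -/

/-- Radius-`r` pins: above `H`, `|S(t) − R(t)| < r`. -/
def RefPinR (H r : ℝ) (R : ℝ → ℝ) : Prop :=
  ∀ t : ℝ, H ≤ t → |zetaArgS t - R t| < r

/-- A radius-`r` pin with `r ≤ 1` is a pin. -/
theorem refPin_of_refPinR {H r : ℝ} {R : ℝ → ℝ} (hr : r ≤ 1) (h : RefPinR H r R) :
    RefPin H R :=
  fun t ht ↦ (h t ht).trans_le hr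

/-- A reference eventually bounded in absolute value pins `S` at NO radius (Selberg `Ω₊`). -/
theorem not_refPinR_of_bounded {H r : ℝ} {R : ℝ → ℝ}
    (hM : ∃ M T : ℝ, ∀ t, T ≤ t → |R t| ≤ M) : ¬ RefPinR H r R := by
  rintro h
  obtain ⟨M, T, hMT⟩ := hM
  obtain ⟨t, ht, hlt⟩ := Selberg1946_zetaArgS_omega_holds.unbounded_above (M + r) (max H T)
  have h1 := (abs_lt.1 (h t ((le_max_left _ _).trans ht))).2
  have h2 := (abs_le.1 (hMT t ((le_max_right _ _).trans ht))).2
  linarith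

/-- (ii″) **Kill at Selberg's RATE.** The tree's `Ω` theorem carries the rate
`selbergRate t = (log t)^{1/3} / (log log t)^{7/3} → ∞`; so a reference dominated ABOVE, beyond some
height, by `ε · selbergRate` for every `ε > 0` — every `R` with `R(t) ≤ C log log t` eventually:
bounded ones, `arg ζ(σ₀+it)`, `± log|ζ(1+it)|`, `log log log t`, … — pins `S` at NO radius. -/
theorem not_refPinR_of_le_rate {H r : ℝ} {R : ℝ → ℝ}
    (hR : ∀ ε : ℝ, 0 < ε → ∃ T : ℝ, ∀ t, T ≤ t → R t ≤ ε * selbergRate t) : ¬ RefPinR H r R := by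
  intro hpin
  obtain ⟨c, hc, hup, -⟩ := Selberg1946_zetaArgS_omega_holds
  obtain ⟨T₁, hT₁⟩ := hR (c / 2) (half_pos hc)
  obtain ⟨T₂, hT₂⟩ := (tendsto_atTop_atTop.1 tendsto_selbergRate_atTop) (2 * (|r| + 1) / c)
  obtain ⟨t, ht, hS⟩ := hup (max (max H T₁) T₂)
  have htH : H ≤ t := ((le_max_left _ _).trans (le_max_left _ _)).trans ht
  have hRt := hT₁ t (((le_max_right _ _).trans (le_max_left _ _)).trans ht)
  have hrate := hT₂ t ((le_max_right _ _).trans ht)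
  have h1 := (abs_lt.1 (hpin t htH)).2
  have h2 : c / 2 * (2 * (|r| + 1) / c) = |r| + 1 := by field_simp
  have h3 : c / 2 * (2 * (|r| + 1) / c) ≤ c / 2 * selbergRate t :=
    mul_le_mul_of_nonneg_left hrate (half_pos hc).le
  have h4 := le_abs_self r
  linarith

/-- … and dominated BELOW by `−ε · selbergRate` (Selberg `Ω₋`). -/
theorem not_refPinR_of_ge_rate {H r : ℝ} {R : ℝ → ℝ}
    (hR : ∀ ε : ℝ, 0 < ε → ∃ T : ℝ, ∀ t, T ≤ t → -(ε * selbergRate t) ≤ R t) : ¬ RefPinR H r R := by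
  intro hpin
  obtain ⟨c, hc, -, hdown⟩ := Selberg1946_zetaArgS_omega_holds
  obtain ⟨T₁, hT₁⟩ := hR (c / 2) (half_pos hc)
  obtain ⟨T₂, hT₂⟩ := (tendsto_atTop_atTop.1 tendsto_selbergRate_atTop) (2 * (|r| + 1) / c)
  obtain ⟨t, ht, hS⟩ := hdown (max (max H T₁) T₂)
  have htH : H ≤ t := ((le_max_left _ _).trans (le_max_left _ _)).trans ht
  have hRt := hT₁ t (((le_max_right _ _).trans (le_max_left _ _)).trans ht)
  have hrate := hT₂ t ((le_max_right _ _).trans ht)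
  have h1 := (abs_lt.1 (hpin t htH)).1
  have h2 : c / 2 * (2 * (|r| + 1) / c) = |r| + 1 := by field_simp
  have h3 : c / 2 * (2 * (|r| + 1) / c) ≤ c / 2 * selbergRate t :=
    mul_le_mul_of_nonneg_left hrate (half_pos hc).le
  have h4 := le_abs_self r
  linarith

/-- Radius-1 form: the residue of §2 sharpened — a surviving reference must be `Ω±` AT SELBERG'S
RATE, in both signs, beyond every height. -/
theorem not_refPin_of_le_rate {H : ℝ} {R : ℝ → ℝ}
    (hR : ∀ ε : ℝ, 0 < ε → ∃ T : ℝ, ∀ t, T ≤ t → R t ≤ ε * selbergRate t) : ¬ RefPin H R :=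
  fun h ↦ not_refPinR_of_le_rate (r := 1) hR h

/-- What survives of a pinning reference, with Selberg's rate: it must cross `±c·selbergRate`
infinitely often in both directions. -/
theorem refPin_residue_rate {H : ℝ} {R : ℝ → ℝ} (h : RefPin H R) :
    (∃ ε : ℝ, 0 < ε ∧ ∀ T : ℝ, ∃ t, T ≤ t ∧ ε * selbergRate t < R t) ∧
    (∃ ε : ℝ, 0 < ε ∧ ∀ T : ℝ, ∃ t, T ≤ t ∧ R t < -(ε * selbergRate t)) := by
  constructor
  · by_contra hc
    push Not at hc
    refine not_refPinR_of_le_rate (r := 1) (fun ε hε ↦ ?_) h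
    obtain ⟨T, hT⟩ := hc ε hε
    exact ⟨T, hT⟩
  · by_contra hc
    push Not at hc
    refine not_refPinR_of_ge_rate (r := 1) (fun ε hε ↦ ?_) h
    obtain ⟨T, hT⟩ := hc ε hε
    exact ⟨T, hT⟩

/-- `LocalRefPin γ`: SOME reference, continuous at `γ` within a left-neighbourhood `[γ − η, γ]`,
pins `S` within radius `1` there. -/
def LocalRefPin (γ : ℝ) : Prop :=
  ∃ R : ℝ → ℝ, ∃ η : ℝ, 0 < η ∧ ContinuousWithinAt R (Set.Icc (γ - η) γ) γ ∧
    ∀ t ∈ Set.Icc (γ - η) γ, |zetaArgS t - R t| < 1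

/-- The local jump principle: a local pin at `γ > H` forces `N(γ) − N(γ − δ) < 2` for some
`δ > 0` with `γ − δ ≥ H`. -/
theorem count_jump_lt_two_of_localRefPin {γ H : ℝ} (hγ : H < γ) (h : LocalRefPin γ) :
    ∃ δ : ℝ, 0 < δ ∧ H ≤ γ - δ ∧ (zetaZeroCount γ : ℝ) - zetaZeroCount (γ - δ) < 2 := by
  obtain ⟨R, η, hη, hR, hpin⟩ := h
  have hγmem : γ ∈ Set.Icc (γ - η) γ := ⟨by linarith, le_rfl⟩
  have hSγ := (abs_lt.1 (hpin γ hγmem)).2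
  obtain ⟨κ, hκ⟩ : ∃ κ : ℝ, κ = R γ + 1 - zetaArgS γ := ⟨_, rfl⟩
  have hκpos : 0 < κ := by linarith
  obtain ⟨δ₀, hδ₀, hθ⟩ :=
    Metric.continuous_iff.1 continuous_riemannSiegelTheta γ (π * (κ / 2)) (by positivity)
  obtain ⟨δ₁, hδ₁, hRc⟩ := (Metric.continuousWithinAt_iff.1 hR) (κ / 2) (by positivity)
  obtain ⟨δ, hδpos, hδ₀', hδ₁', hδH, hδη⟩ :
      ∃ δ : ℝ, 0 < δ ∧ δ < δ₀ ∧ δ < δ₁ ∧ H ≤ γ - δ ∧ δ ≤ η := by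
    have hm1 : min (min (δ₀ / 2) (δ₁ / 2)) (min ((γ - H) / 2) η) ≤ δ₀ / 2 :=
      (min_le_left _ _).trans (min_le_left _ _)
    have hm2 : min (min (δ₀ / 2) (δ₁ / 2)) (min ((γ - H) / 2) η) ≤ δ₁ / 2 :=
      (min_le_left _ _).trans (min_le_right _ _)
    have hm3 : min (min (δ₀ / 2) (δ₁ / 2)) (min ((γ - H) / 2) η) ≤ (γ - H) / 2 :=
      (min_le_right _ _).trans (min_le_left _ _)
    have hm4 : min (min (δ₀ / 2) (δ₁ / 2)) (min ((γ - H) / 2) η) ≤ η :=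
      (min_le_right _ _).trans (min_le_right _ _)
    have hm0 : 0 < min (min (δ₀ / 2) (δ₁ / 2)) (min ((γ - H) / 2) η) :=
      lt_min (lt_min (by linarith) (by linarith)) (lt_min (by linarith) hη)
    exact ⟨_, hm0, by linarith, by linarith, by linarith, hm4⟩
  refine ⟨δ, hδpos, hδH, ?_⟩
  have htmem : γ - δ ∈ Set.Icc (γ - η) γ := ⟨by linarith, by linarith⟩
  have hSt := (abs_lt.1 (hpin (γ - δ) htmem)).1
  have hdist : dist (γ - δ) γ < δ₁ := by
    rw [Real.dist_eq, show γ - δ - γ = -δ by ring, abs_neg, abs_of_pos hδpos]; exact hδ₁'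
  have hRv := hRc htmem hdist
  rw [Real.dist_eq] at hRv
  have hRv' := (abs_lt.1 hRv).1
  have hd : dist (γ - δ) γ < δ₀ := by
    rw [Real.dist_eq, show γ - δ - γ = -δ by ring, abs_neg, abs_of_pos hδpos]; exact hδ₀'
  have hθv := hθ (γ - δ) hd
  rw [Real.dist_eq] at hθv
  have hθv' := (abs_lt.1 hθv).1
  have hX : (riemannSiegelTheta γ - riemannSiegelTheta (γ - δ)) / π < κ / 2 := by
    rw [div_lt_iff₀ Real.pi_pos]
    linarith
  have key := zetaArgS_sub (γ - δ) γ
  linarith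

/-- A global continuous-reference pin is a local pin at every height above `H`. -/
theorem localRefPin_of_refPin {H : ℝ} {R : ℝ → ℝ} (hR : ContinuousOn R (Set.Ici H))
    (h : RefPin H R) {γ : ℝ} (hγ : H < γ) : LocalRefPin γ := by
  refine ⟨R, γ - H, by linarith, ?_, fun t ht ↦ h t (by linarith [ht.1])⟩
  exact (hR γ hγ.le).mono fun t ht ↦ by
    simp only [Set.mem_Icc] at ht
    simp only [Set.mem_Ici]
    linarith [ht.1]

/-- (i, local form) Local pins at every height above `H ≥ 0` give `RHAbove H` … -/
theorem rhAbove_of_localRefPin {H : ℝ} (hH : 0 ≤ H) (h : ∀ γ, H < γ → LocalRefPin γ) :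
    RHAbove H := by
  intro s hs hIm
  by_contra hre
  have h0 : 0 < s.im := hH.trans_lt hIm
  have him : s.im ≠ 0 := h0.ne'
  have hs' : riemannZeta (1 - starRingEnd ℂ s) = 0 := riemannZeta_one_sub_conj_eq_zero hs h0
  have him' : (1 - starRingEnd ℂ s).im = s.im := by simp
  have hres' : (1 - starRingEnd ℂ s).re = 1 - s.re := by simp
  have hne : s ≠ 1 - starRingEnd ℂ s := by
    intro hss
    apply hre
    have := congrArg Complex.re hss
    rw [hres'] at this
    linarith
  have hstrip := re_mem_Ioo_of_riemannZeta_eq_zero_of_im_ne_zero hs him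
  obtain ⟨δ, hδ, -, hlt⟩ := count_jump_lt_two_of_localRefPin hIm (h _ hIm)
  have hjump := two_le_count_jump hs hs' hne him' h0 ⟨hstrip.1.le, hstrip.2.le⟩
    ⟨by rw [hres']; linarith [hstrip.2], by rw [hres']; linarith [hstrip.1]⟩
    (t := s.im - δ) (by linarith)
  linarith

/-- … and simple zeros above `H`. -/
theorem order_eq_one_of_localRefPin {H : ℝ} (hH : 0 ≤ H) (h : ∀ γ, H < γ → LocalRefPin γ)
    {s : ℂ} (hs : riemannZeta s = 0) (hIm : H < s.im) : riemannZetaZeroOrder s = 1 := by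
  have h0 : 0 < s.im := hH.trans_lt hIm
  have hstrip := re_mem_Ioo_of_riemannZeta_eq_zero_of_im_ne_zero hs h0.ne'
  have h1 : (1 : ℤ) ≤ riemannZetaZeroOrder s := by
    have := (riemannZetaZeroOrder_pos_iff (ne_one_of_riemannZeta_eq_zero hs)).2 hs
    omega
  by_contra hne
  have h2 : (2 : ℤ) ≤ riemannZetaZeroOrder s := by omega
  obtain ⟨δ, hδ, -, hlt⟩ := count_jump_lt_two_of_localRefPin hIm (h _ hIm)
  have hjump := two_le_count_jump_of_two_le_order hs h0 ⟨hstrip.1.le, hstrip.2.le⟩ h2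
    (t := s.im - δ) (by linarith)
  linarith

/-- Selberg's prime approximant `P_N(t) = Σ_{p ≤ N} sin(t log p)/√p` is the TREE's `primeSin N`
(`Splittings.ZdTwoHeightDirichlet`, landed lane (x-d)); a fixed-scale one is bounded:
`|P_N(t)| ≤ #{p ≤ N}`. -/
theorem abs_primeSin_le (N : ℕ) (t : ℝ) : |primeSin N t| ≤ (Nat.primesLE N).card := by
  unfold primeSin
  calc |∑ p ∈ Nat.primesLE N, Real.sin (t * Real.log p) / Real.sqrt p|
      ≤ ∑ p ∈ Nat.primesLE N, |Real.sin (t * Real.log p) / Real.sqrt p| :=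
        Finset.abs_sum_le_sum_abs _ _
    _ ≤ ∑ p ∈ Nat.primesLE N, (1 : ℝ) := by
        refine Finset.sum_le_sum fun p hp ↦ ?_
        have hp' : p.Prime := (Nat.mem_primesLE.1 hp).2
        have h1 : (1 : ℝ) ≤ Real.sqrt p :=
          Real.one_le_sqrt.2 (by exact_mod_cast hp'.one_lt.le)
        rw [abs_div, abs_of_pos (lt_of_lt_of_le one_pos h1)]
        calc |Real.sin (t * Real.log p)| / Real.sqrt p
            ≤ |Real.sin (t * Real.log p)| / 1 :=
              div_le_div_of_nonneg_left (abs_nonneg _) one_pos h1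
          _ ≤ 1 := by rw [div_one]; exact Real.abs_sin_le_one _
    _ = ((Nat.primesLE N).card : ℝ) := by simp

/-- (ii) Every FIXED-scale prime reference `c · P_N` (any scale `c`, e.g. `−π⁻¹`) pins `S` at no
radius, at no height (bounded reference vs Selberg `Ω₊`). -/
theorem not_refPinR_primeSin (N : ℕ) (c H r : ℝ) : ¬ RefPinR H r fun t ↦ c * primeSin N t :=
  not_refPinR_of_bounded ⟨|c| * (Nat.primesLE N).card, 0, fun t _ ↦ by
    rw [abs_mul]; exact mul_le_mul_of_nonneg_left (abs_primeSin_le N t) (abs_nonneg _)⟩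

/-- **N68 `PrimePin a r H`** (the explicit-formula pin at the CO-GROWING scale): for every `T ≥ H`,
throughout `[T/2, T]`, `|S(t) + π⁻¹ P_{⌊T^a⌋₊}(t)| < r` (primes `p ≤ ⌊T^a⌋₊`) — Selberg's approximate
formula (Titchmarsh Thm 14.21/14.22, mean-square error `O_a(T)`) promoted to a POINTWISE error `< r`. -/
def PrimePin (a r H : ℝ) : Prop :=
  ∀ T : ℝ, H ≤ T → ∀ t : ℝ, T / 2 ≤ t → t ≤ T → |zetaArgS t + π⁻¹ * primeSin ⌊T ^ a⌋₊ t| < r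

/-- A prime pin of radius `≤ 1` is a local pin at every height above `H ≥ 0` (reference
`−π⁻¹ P_{⌊γ^a⌋₊}` on `[γ/2, γ]`, continuous). -/
theorem localRefPin_of_primePin {a r H : ℝ} (hH : 0 ≤ H) (hr : r ≤ 1) (h : PrimePin a r H)
    {γ : ℝ} (hγ : H < γ) : LocalRefPin γ := by
  have hγ0 : 0 < γ := hH.trans_lt hγ
  refine ⟨fun t ↦ -(π⁻¹ * primeSin ⌊γ ^ a⌋₊ t), γ / 2, by positivity, ?_, fun t ht ↦ ?_⟩
  · exact ((continuous_const.mul (continuous_primeSin' _)).neg).continuousWithinAt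
  · have := h γ hγ.le t (by linarith [ht.1]) ht.2
    simpa [sub_neg_eq_add] using this.trans_le hr

/-- (i) **Every co-growing prime pin of radius `≤ 1` splits**: `PrimePin a r H → RHAbove H`
(`H ≥ 0`, any exponent `a`) … -/
theorem rhAbove_of_primePin {a r H : ℝ} (hH : 0 ≤ H) (hr : r ≤ 1) (h : PrimePin a r H) :
    RHAbove H :=
  rhAbove_of_localRefPin hH fun _ hγ ↦ localRefPin_of_primePin hH hr h hγ

/-- … with simple zeros above `H` … -/
theorem order_eq_one_of_primePin {a r H : ℝ} (hH : 0 ≤ H) (hr : r ≤ 1) (h : PrimePin a r H)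
    {s : ℂ} (hs : riemannZeta s = 0) (hIm : H < s.im) : riemannZetaZeroOrder s = 1 :=
  order_eq_one_of_localRefPin hH (fun _ hγ ↦ localRefPin_of_primePin hH hr h hγ) hs hIm

/-- … so `riemannHypothesisUpTo_platt_trudgian ∧ PrimePin a r 3000175332800 → RH` for every exponent `a` and radius `r ≤ 1`. -/
theorem rh_of_fin_of_primePin {a r : ℝ} (hr : r ≤ 1) (hA : riemannHypothesisUpTo_platt_trudgian) (hB : PrimePin a r 3000175332800) :
    RiemannHypothesis :=
  rh_of_fin_of_rhAbove hA (rhAbove_of_primePin (by norm_num) hr hB)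

end Summit.RiemannHypothesis.RiemannHypothesis.Theorems.Splittings.ZdPrimePin

end
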